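import Summits.BirchSwinnertonDyer.BirchSwinnertonDyer.Theorems.ClassRecordThreeEulerHalvesAtThreeCartanCoverAssembly
import Mathlib.GroupTheory.Transfer
import Mathlib.LinearAlgebra.Matrix.GeneralLinearGroup.Card
import HarnessLib

/-!
# (EXT) Invariant homomorphisms on the level-`q` kernel extend — crux `CartanOnePlaceDegreeLawAtThree` (NUM, stmt-BirchSwinnertonDyer-24801), line `charext`
Typed and proved by the crux ideator `cruxidea-stmt-BirchSwinnertonDyer-24801-1` g0 in `Cruxes/CartanOnePlaceDegreeLawAtThree/Lines/charext.lean` v8 (sha16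
f08f5e2103847d91, farm rc 0); LANDED verbatim (namespace under `Theorems`) by the crux LEAD (bsd-stepL tam3-p1 g27) so that every line imports it BY NAME.
Pure finite group theory (`invariantHomExtendsSL2`): for a prime `q ≡ 1 (mod 3)`, `π : Γ → GL₂(𝔽_q)` with image exactly `SL₂(𝔽_q)` and a `3`-torsion abelian
group `A`, every conjugation-invariant homomorphism `ker π → A` extends to `Γ` — divide by `ker(χ|_N)` (central kernel), transfer to the split-torus preimage
(index `q(q+1)`), Weyl element, `MonoidHom.transfer_eq_pow`, `(q(q+1))² ≡ 1 (mod 3)`. BSD is proved for no curve. [cite: Huppert1967, Kap. V §25, Satz 25.7 (M(SL(2,q)) = 1 for q ≠ 4, 9)]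
-/

set_option linter.dupNamespace false
set_option autoImplicit false

open scoped Classical MatrixGroups

namespace Summit.BirchSwinnertonDyer.BirchSwinnertonDyer.Theorems.CartanCover.Charext

/-- **(EXT) INVARIANT HOMOMORPHISMS ON THE LEVEL-`q` KERNEL EXTEND** [pure finite group theory]: for a prime `q ≡ 1 (3)`, a group `Γ`, a homomorphism
`π : Γ → GL₂(𝔽_q)` with image exactly `SL₂(𝔽_q)`, and a `3`-torsion abelian group `A`: every `Γ`-conjugation-invariant homomorphism `χ : ker π → A` extends
to a homomorphism `Γ → A`. (Inflation–restriction: the obstruction lives in `H²(SL₂(𝔽_q), A) = 0`, as `SL₂(𝔽_q)` is perfect with trivial Schur multiplier for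
`q ≥ 5` prime; equivalently cyclic Sylow-`3` + stable elements.) Why it might fail: it does not for prime `q ≥ 5` (`M(SL₂(9)) ≠ 1` is not prime `q`). [cite: Huppert1967, Kap. V §25, Satz 25.7 (M(SL(2,q)) = 1 for q ≠ 4, 9)] -/
@[conjecture]
def InvariantHomExtendsSL2 : Prop :=
  ∀ (q : ℕ) [Fact q.Prime], q % 3 = 1 →
    ∀ (Γ : Type) [Group Γ] (A : Type) [AddCommGroup A] (π : Γ →* GL (Fin 2) (ZMod q)) (χ : Γ → A),
      (∀ a : A, (3 : ℤ) • a = 0) →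
      (∀ g : GL (Fin 2) (ZMod q), (∃ γ, π γ = g) ↔ Matrix.det (g : Matrix (Fin 2) (Fin 2) (ZMod q)) = 1) →
      (∀ β₁ β₂ : Γ, π β₁ = 1 → π β₂ = 1 → χ (β₁ * β₂) = χ β₁ + χ β₂) →
      (∀ γ β : Γ, π β = 1 → χ (γ * β * γ⁻¹) = χ β) →
      ∃ χ' : Γ → A, (∀ γ δ : Γ, χ' (γ * δ) = χ' γ + χ' δ) ∧ ∀ β : Γ, π β = 1 → χ' β = χ β

/-! ### (EXT) Invariant homomorphisms on the level-`q` kernel extend — PROVED (v7): split torus, index `q(q+1)`, transfer -/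

namespace EXT

variable {q : ℕ} [Fact q.Prime]

/-- `diag(a, a⁻¹) ∈ GL₂(𝔽_q)`. [folklore] -/
def torusElt (a : (ZMod q)ˣ) : GL (Fin 2) (ZMod q) :=
  ⟨!![(a : ZMod q), 0; 0, ((a⁻¹ : (ZMod q)ˣ) : ZMod q)],
   !![((a⁻¹ : (ZMod q)ˣ) : ZMod q), 0; 0, (a : ZMod q)],
   by rw [Matrix.mul_fin_two, Matrix.one_fin_two, Units.mul_inv, Units.inv_mul]; simp only [mul_zero, zero_mul, add_zero, zero_add],
   by rw [Matrix.mul_fin_two, Matrix.one_fin_two, Units.mul_inv, Units.inv_mul]; simp only [mul_zero, zero_mul, add_zero, zero_add]⟩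

/-- the matrix of `diag(a, a⁻¹)`. [folklore] -/
@[simp] theorem coe_torusElt (a : (ZMod q)ˣ) :
    ((torusElt a : GL (Fin 2) (ZMod q)) : Matrix (Fin 2) (Fin 2) (ZMod q)) =
      !![(a : ZMod q), 0; 0, ((a⁻¹ : (ZMod q)ˣ) : ZMod q)] := rfl

/-- the split torus as a homomorphism `𝔽_q^× → GL₂(𝔽_q)`. [folklore] -/
def torusHom : (ZMod q)ˣ →* GL (Fin 2) (ZMod q) where
  toFun := torusElt
  map_one' := by
    apply Units.ext
    rw [coe_torusElt, inv_one, Units.val_one, Units.val_one, Matrix.one_fin_two]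
  map_mul' a b := by
    apply Units.ext
    rw [Units.val_mul, coe_torusElt, coe_torusElt, coe_torusElt, Matrix.mul_fin_two, mul_inv, Units.val_mul, Units.val_mul]
    simp only [mul_zero, zero_mul, add_zero, zero_add]
/-- `torusHom a = diag(a, a⁻¹)`. [folklore] -/
theorem torusHom_apply (a : (ZMod q)ˣ) : torusHom a = torusElt a := rfl
/-- the split torus homomorphism is injective. [folklore] -/
theorem torusHom_injective : Function.Injective (torusHom (q := q)) := by
  intro a b h
  have h' := congrArg (fun g : GL (Fin 2) (ZMod q) => (g : Matrix (Fin 2) (Fin 2) (ZMod q)) 0 0) h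
  simp only [torusHom_apply, coe_torusElt, Matrix.of_apply, Matrix.cons_val', Matrix.cons_val_zero] at h'
  exact Units.ext h'
/-- `det diag(a, a⁻¹) = 1`. [folklore] -/
theorem det_torusElt (a : (ZMod q)ˣ) : Matrix.det ((torusElt a : GL (Fin 2) (ZMod q)) : Matrix (Fin 2) (Fin 2) (ZMod q)) = 1 := by
  rw [coe_torusElt, Matrix.det_fin_two_of, Units.mul_inv]; ring

/-- the Weyl element `w = [[0,1],[-1,0]]`. [folklore] -/
def weyl : GL (Fin 2) (ZMod q) :=
  ⟨!![0, 1; -1, 0], !![0, -1; 1, 0], by rw [Matrix.mul_fin_two, Matrix.one_fin_two]; simp only [mul_zero, add_zero, zero_add, mul_one, mul_neg, neg_zero, neg_neg],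
    by rw [Matrix.mul_fin_two, Matrix.one_fin_two]; simp only [mul_zero, add_zero, zero_add, mul_one, mul_neg, neg_zero, neg_neg]⟩
/-- `det w = 1`. [folklore] -/
theorem det_weyl : Matrix.det ((weyl : GL (Fin 2) (ZMod q)) : Matrix (Fin 2) (Fin 2) (ZMod q)) = 1 := by
  show Matrix.det !![(0 : ZMod q), 1; -1, 0] = 1
  rw [Matrix.det_fin_two_of]; ring

/-- `w · diag(a,a⁻¹) = diag(a⁻¹,a) · w`. [folklore] -/
theorem weyl_mul_torusElt (a : (ZMod q)ˣ) : (weyl : GL (Fin 2) (ZMod q)) * torusElt a = torusElt a⁻¹ * weyl := by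
  apply Units.ext
  rw [Units.val_mul, Units.val_mul, coe_torusElt, coe_torusElt, inv_inv]
  show !![(0 : ZMod q), 1; -1, 0] * _ = _ * !![(0 : ZMod q), 1; -1, 0]
  rw [Matrix.mul_fin_two, Matrix.mul_fin_two]
  simp only [mul_zero, zero_mul, add_zero, zero_add, mul_one, one_mul, neg_mul, mul_neg, neg_zero]

/-- `det : GL₂(𝔽_q) → 𝔽_q^×` is onto. [folklore] -/
theorem det_surjective : Function.Surjective (Matrix.GeneralLinearGroup.det : GL (Fin 2) (ZMod q) →* (ZMod q)ˣ) := by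
  intro u
  refine ⟨⟨!![(u : ZMod q), 0; 0, 1], !![((u⁻¹ : (ZMod q)ˣ) : ZMod q), 0; 0, 1], ?_, ?_⟩, ?_⟩
  · rw [Matrix.mul_fin_two, Matrix.one_fin_two, Units.mul_inv]; simp only [mul_zero, zero_mul, add_zero, zero_add, mul_one]
  · rw [Matrix.mul_fin_two, Matrix.one_fin_two, Units.inv_mul]; simp only [mul_zero, zero_mul, add_zero, zero_add, mul_one]
  · apply Units.ext
    rw [Matrix.GeneralLinearGroup.val_det_apply]
    show Matrix.det !![(u : ZMod q), 0; 0, 1] = u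
    rw [Matrix.det_fin_two_of]; ring

/-- `|GL₂(𝔽_q)| = (q² − 1)(q² − q)`. [folklore] -/
theorem card_GL_two : Nat.card (GL (Fin 2) (ZMod q)) = (q ^ 2 - 1) * (q ^ 2 - q) := by
  rw [Matrix.card_GL_field 2, Fin.prod_univ_two, ZMod.card q]
  simp

/-- the determinant-one subgroup. -/
def detOne : Subgroup (GL (Fin 2) (ZMod q)) := (Matrix.GeneralLinearGroup.det : GL (Fin 2) (ZMod q) →* (ZMod q)ˣ).ker
/-- membership in the determinant-one subgroup. [folklore] -/
theorem mem_detOne {g : GL (Fin 2) (ZMod q)} : g ∈ (detOne : Subgroup (GL (Fin 2) (ZMod q))) ↔ Matrix.det (g : Matrix (Fin 2) (Fin 2) (ZMod q)) = 1 := by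
  rw [detOne, MonoidHom.mem_ker, ← Units.val_eq_one, Matrix.GeneralLinearGroup.val_det_apply]

/-- `|SL₂(𝔽_q)| · (q − 1) = |GL₂(𝔽_q)|`. [folklore] -/
theorem card_detOne_mul : Nat.card (detOne : Subgroup (GL (Fin 2) (ZMod q))) * (q - 1) = (q ^ 2 - 1) * (q ^ 2 - q) := by
  have h1 : (detOne : Subgroup (GL (Fin 2) (ZMod q))).index = q - 1 := by
    rw [detOne, Subgroup.index_ker, MonoidHom.range_eq_top.mpr det_surjective, Subgroup.card_top, Nat.card_eq_fintype_card,
      ZMod.card_units]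
  rw [← h1, Subgroup.card_mul_index, card_GL_two]
/-- the split torus lies in `SL₂(𝔽_q)`. [folklore] -/
theorem torusHom_range_le_detOne : (torusHom (q := q)).range ≤ detOne := by
  rintro g ⟨a, rfl⟩
  rw [mem_detOne, torusHom_apply, det_torusElt]
/-- `|T_s| = q − 1`. [folklore] -/
theorem card_torusHom_range : Nat.card (torusHom (q := q)).range = q - 1 := by
  rw [← Nat.card_congr (MonoidHom.ofInjective torusHom_injective).toEquiv, Nat.card_eq_fintype_card, ZMod.card_units]

/-- `[SL₂(𝔽_q) : T_s] = q(q+1)`. [folklore] -/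
theorem relIndex_torus_detOne : (torusHom (q := q)).range.relIndex detOne = q * (q + 1) := by
  have hq2 : 2 ≤ q := (Fact.out : q.Prime).two_le
  have h := Subgroup.card_mul_index ((torusHom (q := q)).range.subgroupOf detOne)
  rw [Nat.card_congr (Subgroup.subgroupOfEquivOfLe torusHom_range_le_detOne).toEquiv, card_torusHom_range] at h
  -- h : (q - 1) * relIndex = Nat.card detOne
  have h2 := card_detOne_mul (q := q)
  rw [← h] at h2
  -- (q-1) * r * (q-1) = (q^2-1)*(q^2-q)
  have hq1 : 0 < q - 1 := by omega
  have key : (q ^ 2 - 1) * (q ^ 2 - q) = (q - 1) * (q * (q + 1)) * (q - 1) := by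
    have e1 : q ^ 2 - 1 = (q - 1) * (q + 1) := by
      rw [Nat.mul_comm, ← Nat.sq_sub_sq, one_pow]
    have e2 : q ^ 2 - q = q * (q - 1) := by
      rw [Nat.mul_sub, mul_one, sq]
    rw [e1, e2]; ring
  rw [key] at h2
  have h3 := Nat.eq_of_mul_eq_mul_right hq1 h2
  exact Nat.eq_of_mul_eq_mul_left hq1 h3

/-- the INDEX of the split-torus preimage: `[E : π⁻¹(T_s)] = q(q+1)` for any `π : E → GL₂(𝔽_q)` with image `SL₂(𝔽_q)`. [folklore] -/
theorem index_torus_comap {E : Type} [Group E] (π : E →* GL (Fin 2) (ZMod q))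
    (himg : ∀ g, (∃ γ, π γ = g) ↔ Matrix.det (g : Matrix (Fin 2) (Fin 2) (ZMod q)) = 1) :
    ((torusHom (q := q)).range.comap π).index = q * (q + 1) := by
  have hr : π.range = detOne := by
    ext g
    rw [MonoidHom.mem_range, mem_detOne]
    exact himg g
  rw [Subgroup.index_comap, hr, relIndex_torus_detOne]

/-! ### Small additive arithmetic in a `3`-torsion group -/

/-- in a `3`-torsion group, `a + a = 0` forces `a = 0`. [folklore] -/
theorem eq_zero_of_three_two {A : Type} [AddCommGroup A] (a : A) (h3 : (3 : ℤ) • a = 0) (h2 : a + a = 0) : a = 0 := by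
  have e : (3 : ℤ) • a = a + a + a := by
    rw [show (3 : ℤ) = 1 + 1 + 1 by norm_num, add_zsmul, add_zsmul, one_zsmul]
  rw [e, h2, zero_add] at h3
  exact h3
/-- in a `3`-torsion group, `n • a = 0` for `3 ∣ n`. [folklore] -/
theorem zsmul_eq_zero_of_mod_three {A : Type} [AddCommGroup A] (a : A) (h3 : (3 : ℤ) • a = 0) (n : ℤ) (hn : n % 3 = 0) :
    n • a = 0 := by
  have : n = (n / 3) * 3 := by omega
  rw [this, mul_smul, h3, smul_zero]
/-- in a `3`-torsion group, `n • a = a` for `n ≡ 1 (mod 3)`. [folklore] -/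
theorem zsmul_eq_self_of_mod_three {A : Type} [AddCommGroup A] (a : A) (h3 : (3 : ℤ) • a = 0) (n : ℤ) (hn : n % 3 = 1) :
    n • a = a := by
  have : n = (n / 3) * 3 + 1 := by omega
  rw [this, add_zsmul, one_zsmul, mul_smul, h3, smul_zero, zero_add]

/-! ### The central case: a central extension of `SL₂(𝔽_q)` by a `3`-torsion group, `q ≡ 1 (mod 3)` -/

/-- **EXT, central version.** If `π : E → GL₂(𝔽_q)` has image `SL₂(𝔽_q)`, its kernel is CENTRAL, and `χ` is additive on the kernel with values in a
`3`-torsion group, then `χ` extends to a homomorphism on `E` (for `q ≡ 1 (mod 3)`). Proof: transfer `E → π⁻¹(T_s)` (index `q(q+1)`, prime to `3`) of the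
homomorphism `x ↦ χ(x·t̃^{−k})` on the (abelian) torus preimage, whose well-definedness is the Weyl-element computation `χ(t̃^{q−1}) = 0`. [folklore] -/
theorem ext_central (hq1 : q % 3 = 1) {E : Type} [Group E] {A : Type} [AddCommGroup A]
    (π : E →* GL (Fin 2) (ZMod q)) (χ : E → A)
    (h3 : ∀ a : A, (3 : ℤ) • a = 0)
    (himg : ∀ g, (∃ γ, π γ = g) ↔ Matrix.det (g : Matrix (Fin 2) (Fin 2) (ZMod q)) = 1)
    (hadd : ∀ β₁ β₂, π β₁ = 1 → π β₂ = 1 → χ (β₁ * β₂) = χ β₁ + χ β₂)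
    (hcent : ∀ e z : E, π z = 1 → e * z = z * e) :
    ∃ χ' : E → A, (∀ γ δ, χ' (γ * δ) = χ' γ + χ' δ) ∧ ∀ β, π β = 1 → χ' β = χ β := by
  classical
  have hq2 : 2 ≤ q := (Fact.out : q.Prime).two_le
  -- basic facts about χ on the kernel
  have hχ1 : χ 1 = 0 := by
    have h := hadd 1 1 (map_one π) (map_one π)
    rw [mul_one] at h
    have h' : χ 1 + χ 1 = χ 1 + 0 := by rw [add_zero]; exact h.symm
    exact add_left_cancel h'
  have hχpow : ∀ z : E, π z = 1 → ∀ n : ℕ, χ (z ^ n) = (n : ℤ) • χ z := by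
    intro z hz n
    induction n with
    | zero => rw [pow_zero, hχ1, Nat.cast_zero, zero_smul]
    | succ n ih =>
        rw [pow_succ, hadd _ _ (by rw [map_pow, hz, one_pow]) hz, ih, Nat.cast_succ, add_zsmul, one_zsmul]
  have hχinv : ∀ z : E, π z = 1 → χ z⁻¹ = -χ z := by
    intro z hz
    have h := hadd z z⁻¹ hz (by rw [map_inv, hz, inv_one])
    rw [mul_inv_cancel, hχ1] at h
    exact (eq_neg_of_add_eq_zero_right h.symm)
  have hχzpow : ∀ z : E, π z = 1 → ∀ n : ℤ, χ (z ^ n) = n • χ z := by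
    intro z hz n
    cases n with
    | ofNat n => rw [Int.ofNat_eq_natCast, zpow_natCast, hχpow z hz n]
    | negSucc n =>
        rw [zpow_negSucc, hχinv _ (by rw [map_pow, hz, one_pow]), hχpow z hz, Int.negSucc_eq, neg_zsmul]
        push_cast; rfl
  -- a generator of `𝔽_q^×`, lifts of the torus generator and of the Weyl element
  obtain ⟨g₀, hg₀⟩ := IsCyclic.exists_generator (α := (ZMod q)ˣ)
  have hord : orderOf g₀ = q - 1 := by
    rw [orderOf_eq_card_of_forall_mem_zpowers hg₀, Nat.card_eq_fintype_card, ZMod.card_units]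
  obtain ⟨t, ht⟩ := (himg (torusHom g₀)).mpr (by rw [torusHom_apply]; exact det_torusElt g₀)
  obtain ⟨w, hw⟩ := (himg (weyl (q := q))).mpr det_weyl
  have hζ : π (t ^ (q - 1)) = 1 := by
    rw [map_pow, ht, ← map_pow, ZMod.units_pow_card_sub_one_eq_one, map_one]
  have hu : π (w * t * w⁻¹ * t) = 1 := by
    rw [map_mul, map_mul, map_mul, map_inv, hw, ht, torusHom_apply, weyl_mul_torusElt, mul_inv_cancel_right,
      ← torusHom_apply, ← torusHom_apply, ← map_mul, inv_mul_cancel, map_one]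
  -- the Weyl computation: χ(t^{q-1}) = 0
  have hχζ : χ (t ^ (q - 1)) = 0 := by
    have e1 : w * t ^ (q - 1) * w⁻¹ = t ^ (q - 1) := by
      rw [hcent w _ hζ, mul_inv_cancel_right]
    have e2 : w * t ^ (q - 1) * w⁻¹ = (w * t * w⁻¹) ^ (q - 1) := conj_pow.symm
    have e3 : w * t * w⁻¹ = (w * t * w⁻¹ * t) * t⁻¹ := by rw [mul_inv_cancel_right]
    have hc : Commute (w * t * w⁻¹ * t) t⁻¹ := (hcent t⁻¹ _ hu).symm
    rw [e1, e3, hc.mul_pow, inv_pow] at e2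
    -- e2 : t^(q-1) = u^(q-1) * (t^(q-1))⁻¹
    have e4 : t ^ (q - 1) * t ^ (q - 1) = (w * t * w⁻¹ * t) ^ (q - 1) := by
      rw [eq_mul_inv_iff_mul_eq] at e2; exact e2
    have e5 := congrArg χ e4
    rw [hadd _ _ hζ hζ, hχpow _ hu] at e5
    have hq3 : ((q - 1 : ℕ) : ℤ) % 3 = 0 := by omega
    rw [zsmul_eq_zero_of_mod_three _ (h3 _) _ hq3] at e5
    exact eq_zero_of_three_two _ (h3 _) e5
  -- powers of t in the kernel have χ = 0
  have hW : ∀ m : ℤ, π (t ^ m) = 1 → χ (t ^ m) = 0 := by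
    intro m hm
    rw [map_zpow, ht, ← map_zpow] at hm
    have hm1 : g₀ ^ m = 1 := torusHom_injective (by rw [hm, map_one])
    obtain ⟨j, hj⟩ := (orderOf_dvd_iff_zpow_eq_one.mpr hm1)
    rw [hord] at hj
    rw [hj, zpow_mul, zpow_natCast, hχzpow _ hζ, hχζ, smul_zero]
  -- the torus preimage and its index
  have hidx : ((torusHom (q := q)).range.comap π).index = q * (q + 1) := index_torus_comap π himg
  haveI hFI : ((torusHom (q := q)).range.comap π).FiniteIndex := ⟨by rw [hidx]; positivity⟩
  -- exponents
  have hk : ∀ x : ↥((torusHom (q := q)).range.comap π), ∃ k : ℤ, π ((x : E) * t ^ (-k)) = 1 := by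
    intro x
    obtain ⟨a, ha⟩ := Subgroup.mem_comap.mp x.2
    obtain ⟨k, hk⟩ := Subgroup.mem_zpowers_iff.mp (hg₀ a)
    refine ⟨k, ?_⟩
    rw [map_mul, map_zpow, ht, ← map_zpow, ← ha, ← map_mul, ← hk, ← zpow_add, add_neg_cancel, zpow_zero, map_one]
  choose kf hkf using hk
  -- normalisations agree
  have hnorm : ∀ (x : E) (k k' : ℤ), π (x * t ^ (-k)) = 1 → π (x * t ^ (-k')) = 1 → χ (x * t ^ (-k)) = χ (x * t ^ (-k')) := by
    intro x k k' h1 h2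
    have e : x * t ^ (-k') = (x * t ^ (-k)) * t ^ (k - k') := by
      rw [mul_assoc, ← zpow_add]; congr 2; ring
    have h3' : π (t ^ (k - k')) = 1 := by
      rw [e, map_mul, h1, one_mul] at h2; exact h2
    rw [e, hadd _ _ h1 h3', hW _ h3', add_zero]
  obtain ⟨f, hf⟩ : ∃ f : ↥((torusHom (q := q)).range.comap π) → A, ∀ x, f x = χ ((x : E) * t ^ (-(kf x))) := ⟨_, fun _ => rfl⟩
  have hfker : ∀ x : ↥((torusHom (q := q)).range.comap π), π (x : E) = 1 → f x = χ x := by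
    intro x hx
    have h0 : π ((x : E) * t ^ (-(0 : ℤ))) = 1 := by rw [neg_zero, zpow_zero, mul_one]; exact hx
    rw [hf, hnorm (x : E) (kf x) 0 (hkf x) h0, neg_zero, zpow_zero, mul_one]
  have hfmul : ∀ x y : ↥((torusHom (q := q)).range.comap π), f (x * y) = f x + f y := by
    intro x y
    have e : ((x : E) * t ^ (-(kf x))) * ((y : E) * t ^ (-(kf y))) = ((x * y : ↥((torusHom (q := q)).range.comap π)) : E) * t ^ (-(kf x + kf y)) := by
      have hc := hcent (t ^ (-(kf x))) _ (hkf y)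
      rw [Subgroup.coe_mul, mul_assoc (x : E), hc, ← mul_assoc, ← mul_assoc, mul_assoc _ (t ^ (-(kf y))) (t ^ (-(kf x))), ← zpow_add]
      congr 2; ring
    have h1 : π (((x * y : ↥((torusHom (q := q)).range.comap π)) : E) * t ^ (-(kf x + kf y))) = 1 := by
      rw [← e, map_mul, hkf x, hkf y, one_mul]
    rw [hf (x * y), hnorm _ _ _ (hkf (x * y)) h1, ← e, hadd _ _ (hkf x) (hkf y), ← hf, ← hf]
  have hf1 : f 1 = 0 := by rw [hfker 1 (by rw [Subgroup.coe_one, map_one]), Subgroup.coe_one, hχ1]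
  obtain ⟨ϕ, hϕ⟩ : ∃ ϕ : ↥((torusHom (q := q)).range.comap π) →* Multiplicative A, ∀ x, ϕ x = Multiplicative.ofAdd (f x) :=
    ⟨{ toFun := fun x => Multiplicative.ofAdd (f x),
       map_one' := by rw [hf1]; rfl,
       map_mul' := fun x y => by rw [hfmul, ofAdd_add] }, fun _ => rfl⟩
  -- the transfer and its value on the (central) kernel
  have hV : ∀ z : E, π z = 1 → MonoidHom.transfer ϕ z = Multiplicative.ofAdd ((((torusHom (q := q)).range.comap π).index : ℤ) • χ z) := by
    intro z hz
    have key : ∀ (k : ℕ) (g : E), g⁻¹ * z ^ k * g ∈ (torusHom (q := q)).range.comap π → g⁻¹ * z ^ k * g = z ^ k := by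
      intro k g _
      rw [mul_assoc, (hcent g (z ^ k) (by rw [map_pow, hz, one_pow])).symm, ← mul_assoc, inv_mul_cancel, one_mul]
    rw [MonoidHom.transfer_eq_pow ϕ z key, hϕ, hfker _ (by rw [map_pow, hz, one_pow]), hχpow _ hz]
  refine ⟨fun e => ((((torusHom (q := q)).range.comap π).index : ℤ)) • Multiplicative.toAdd (MonoidHom.transfer ϕ e), ?_, ?_⟩
  · intro γ δ
    simp only [map_mul, toAdd_mul, smul_add]
  · intro β hβ
    simp only [hV β hβ, toAdd_ofAdd, smul_smul, hidx]
    have hn : (q * (q + 1)) % 3 = 2 := by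
      rw [Nat.mul_mod, Nat.add_mod, hq1]
    have hn2 : (q * (q + 1) * (q * (q + 1))) % 3 = 1 := by
      rw [Nat.mul_mod, hn]
    have hn3 : (((q * (q + 1) * (q * (q + 1)) : ℕ)) : ℤ) % 3 = 1 := by exact_mod_cast hn2
    have := zsmul_eq_self_of_mod_three _ (h3 (χ β)) _ hn3
    push_cast at this
    exact this

/-! ### (EXT) PROVED: pass to `Γ ∕ ker(χ|_N)`, where the kernel of `π` becomes central -/

/-- **(EXT) `InvariantHomExtendsSL2` — PROVED.** Divide by `K = {β ∈ N : χ β = 0}` (normal by invariance); on `E = Γ∕K` the kernel of `π̄` is central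
(invariance again) and `ext_central` applies. [folklore] -/
theorem invariantHomExtendsSL2_proof (hq1 : q % 3 = 1) (Γ : Type) [Group Γ] (A : Type) [AddCommGroup A]
    (π : Γ →* GL (Fin 2) (ZMod q)) (χ : Γ → A)
    (h3 : ∀ a : A, (3 : ℤ) • a = 0)
    (himg : ∀ g, (∃ γ, π γ = g) ↔ Matrix.det (g : Matrix (Fin 2) (Fin 2) (ZMod q)) = 1)
    (hadd : ∀ β₁ β₂, π β₁ = 1 → π β₂ = 1 → χ (β₁ * β₂) = χ β₁ + χ β₂)
    (hconj : ∀ γ β, π β = 1 → χ (γ * β * γ⁻¹) = χ β) :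
    ∃ χ' : Γ → A, (∀ γ δ, χ' (γ * δ) = χ' γ + χ' δ) ∧ ∀ β, π β = 1 → χ' β = χ β := by
  classical
  have hχ1 : χ 1 = 0 := by
    have h := hadd 1 1 (map_one π) (map_one π)
    rw [mul_one] at h
    have h' : χ 1 + χ 1 = χ 1 + 0 := by rw [add_zero]; exact h.symm
    exact add_left_cancel h'
  have hχinv : ∀ z : Γ, π z = 1 → χ z⁻¹ = -χ z := by
    intro z hz
    have h := hadd z z⁻¹ hz (by rw [map_inv, hz, inv_one])
    rw [mul_inv_cancel, hχ1] at h
    exact (eq_neg_of_add_eq_zero_right h.symm)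
  let K : Subgroup Γ :=
    { carrier := {β | π β = 1 ∧ χ β = 0}
      mul_mem' := fun {a b} ha hb => ⟨by rw [map_mul, ha.1, hb.1, one_mul], by rw [hadd _ _ ha.1 hb.1, ha.2, hb.2, add_zero]⟩
      one_mem' := ⟨map_one π, hχ1⟩
      inv_mem' := fun {a} ha => ⟨by rw [map_inv, ha.1, inv_one], by rw [hχinv _ ha.1, ha.2, neg_zero]⟩ }
  have hKmem : ∀ β, β ∈ K ↔ π β = 1 ∧ χ β = 0 := fun _ => Iff.rfl
  haveI hKN : K.Normal := ⟨fun β hβ γ => (hKmem _).mpr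
    ⟨by rw [map_mul, map_mul, map_inv, ((hKmem β).mp hβ).1, mul_one, mul_inv_cancel],
     by rw [hconj γ β ((hKmem β).mp hβ).1, ((hKmem β).mp hβ).2]⟩⟩
  have hKle : K ≤ π.ker := fun β hβ => by rw [MonoidHom.mem_ker]; exact ((hKmem β).mp hβ).1
  let πb : Γ ⧸ K →* GL (Fin 2) (ZMod q) := QuotientGroup.lift K π hKle
  have hπb : ∀ γ : Γ, πb (γ : Γ ⧸ K) = π γ := fun γ => QuotientGroup.lift_mk K hKle γ
  obtain ⟨χb, hχb0⟩ : ∃ χb : Γ ⧸ K → A, ∀ e, χb e = χ (Quotient.out e) := ⟨_, fun _ => rfl⟩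
  have hχb : ∀ β, π β = 1 → χb (β : Γ ⧸ K) = χ β := by
    intro β hβ
    obtain ⟨⟨k, hk⟩, e⟩ := QuotientGroup.mk_out_eq_mul K β
    rw [hχb0]
    show χ (Quotient.out (QuotientGroup.mk β : Γ ⧸ K)) = χ β
    rw [e, hadd β k hβ ((hKmem k).mp hk).1, ((hKmem k).mp hk).2, add_zero]
  have himg' : ∀ g, (∃ e, πb e = g) ↔ Matrix.det (g : Matrix (Fin 2) (Fin 2) (ZMod q)) = 1 := by
    intro g
    rw [← himg g]
    constructor
    · rintro ⟨e, he⟩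
      induction e using QuotientGroup.induction_on with
      | H γ => exact ⟨γ, by rw [← hπb, he]⟩
    · rintro ⟨γ, hγ⟩
      exact ⟨γ, by rw [hπb, hγ]⟩
  have hadd' : ∀ e₁ e₂, πb e₁ = 1 → πb e₂ = 1 → χb (e₁ * e₂) = χb e₁ + χb e₂ := by
    intro e₁ e₂ h1 h2
    induction e₁ using QuotientGroup.induction_on with
    | H γ₁ =>
      induction e₂ using QuotientGroup.induction_on with
      | H γ₂ =>
        rw [hπb] at h1 h2
        rw [← QuotientGroup.mk_mul, hχb _ (by rw [map_mul, h1, h2, one_mul]), hχb _ h1, hχb _ h2, hadd _ _ h1 h2]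
  have hcent' : ∀ e z : Γ ⧸ K, πb z = 1 → e * z = z * e := by
    intro e z hz
    induction e using QuotientGroup.induction_on with
    | H γ =>
      induction z using QuotientGroup.induction_on with
      | H β =>
        rw [hπb] at hz
        rw [← QuotientGroup.mk_mul, ← QuotientGroup.mk_mul, QuotientGroup.eq, hKmem]
        have e : (γ * β)⁻¹ * (β * γ) = β⁻¹ * (γ⁻¹ * β * γ⁻¹⁻¹) := by group
        have hc : π (γ⁻¹ * β * γ⁻¹⁻¹) = 1 := by
          rw [inv_inv, map_mul, map_mul, hz, mul_one, map_inv, inv_mul_cancel]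
        have hb : π β⁻¹ = 1 := by rw [map_inv, hz, inv_one]
        refine ⟨?_, ?_⟩
        · rw [e, map_mul, hb, hc, one_mul]
        · rw [e, hadd _ _ hb hc, hχinv _ hz, hconj _ _ hz, neg_add_cancel]
  obtain ⟨χ'b, h1, h2⟩ := ext_central hq1 πb χb h3 himg' hadd' hcent'
  refine ⟨fun γ => χ'b (γ : Γ ⧸ K), fun γ δ => ?_, fun β hβ => ?_⟩
  · show χ'b ((γ * δ : Γ) : Γ ⧸ K) = _
    rw [QuotientGroup.mk_mul]; exact h1 _ _
  · show χ'b (β : Γ ⧸ K) = χ β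
    rw [h2 _ (by rw [hπb]; exact hβ), hχb β hβ]

end EXT

/-- **(EXT) PROVED (was `stub_invariantHomExtendsSL2` in v1–v6): `InvariantHomExtendsSL2`.** Pure finite group theory: divide by `ker(χ|_N)` so that `N` becomes
CENTRAL, then TRANSFER `E → π⁻¹(T_s)` to the preimage of the split torus (index `q(q+1)`, prime to `3` as `q ≡ 1 (3)`) of the homomorphism
`x ↦ χ(x·t̃^{−k})` (`π x = diag(g₀^k, g₀^{−k})`), which is well defined because the Weyl element forces `χ(t̃^{q−1}) = 0`; the transfer restricted to the
central kernel is the `q(q+1)`-th power map (`MonoidHom.transfer_eq_pow`), and `(q(q+1))² ≡ 1 (mod 3)`. [folklore] -/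
theorem invariantHomExtendsSL2 : InvariantHomExtendsSL2 :=
  fun _ _ hq1 Γ _ A _ π χ h3 himg hadd hconj => EXT.invariantHomExtendsSL2_proof hq1 Γ A π χ h3 himg hadd hconj

end Summit.BirchSwinnertonDyer.BirchSwinnertonDyer.Theorems.CartanCover.Charext
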